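import Summits.FinalStateConjecture.FinalStateConjecture.Theorems.EIHFluxBalanceModulatedKerrHandoffBentLabDeviationAux4
import Summits.FinalStateConjecture.FinalStateConjecture.Theorems.EIHFluxBalanceModulatedKerrHandoffBentLabDeviationAux1
import Literature.Geometry.Lorentzian.KerrSchildCoord
import Literature.Geometry.Lorentzian.KerrWaveEnergy
import HarnessLib

set_option linter.dupNamespace false
-- instance search through the nested operator type `E4 →L[ℝ] E4 →L[ℝ] ℝ` (as in the tree files)
set_option maxSynthPendingDepth 3

/-!
# Stub `stub_bentLabDeviation` (T3b) of line `swallow-transfer`, crux `EIHFluxBalance.ModulatedKerrHandoff` (stmt-FinalStateConjecture-10167)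

Support file for crux `stmt-FinalStateConjecture-10167`
(`Summit.FinalStateConjecture.FinalStateConjecture.Theses.EIHFluxBalance.ModulatedKerrHandoff`), line
`swallow-transfer`: the registered stub `stub_bentLabDeviation` (statement VERBATIM from the registered skeleton
`Cruxes/ModulatedKerrHandoff/Lines/swallow_transfer.lean`).

**The deviation of the bent lab chart.** With the bent shift `Θ(x) = χ₁(|x̲|/x⁰ − 1) · T(|x̲|)`
(`χ₁ = Real.smoothTransition`, `T = bentHeight M a`, `|x̲| = E4.spatialNorm x`) and the bent lab chart
`f(x) = x + Θ(x) e₀`, the zero-extended coordinate deviation is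
`e(x) = g_{M,a}(f x)(Df_x ·, Df_x ·) − g_{M,a}(x)` on the pinned domain `V = {x⁰ > τ₀, r > rin}` and `0` elsewhere
(`g_{M,a} = Kerr.bilin M a`, `r = Kerr.radius a`). Given the shift bounds of stub T3a (`Θ` smooth on `{x⁰ > 0}`,
`‖DⁱΘ(x)‖ ≤ ε(x⁰) → 0` for `1 ≤ i ≤ 4`), this file proves:

* (i) the `C³` sup norm of `e` over the lab slab `{x ∈ V | x⁰ = t}` tends to `0` as `t → ∞`: inside the cone
  `|x̲| < x⁰` the shift vanishes near `x`, so `f = id` near `x` and `e ≡ 0` near `x`; outside, `x ∈ V` and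
  `r(x) ≥ R` for late `t` (`r² ≥ |x̲|² − a²`, `Kerr.spatialNorm_sq_sub_sq_le_radius_sq`), where all derivatives of
  orders `≤ 3` of the STATIONARY field `g_{M,a}` (`Kerr.bilin_add_smul_basisVector_zero`) are bounded by one
  constant `N` (`Kerr.norm_iteratedFDeriv_ksPert_le`, `η` constant), so the time-shift engine
  `BentLabDeviation.bentLabDeviation_shiftDeviation_estimate` gives `‖Dᵐe(x)‖ ≤ 3 · 4ᵐ · N · ε(t)`;
* (ii) all derivatives of `e` vanish at the points of the cone `|x̲| ≤ x⁰/2`, `x⁰ > τ₀` (both branches of `e`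
  are `0` near such a point).

References: elementary calculus. [folklore]
-/

noncomputable section

open scoped ContDiff Topology ENNReal
open Set Filter Topology Literature.Geometry.Lorentzian
open Summit.FinalStateConjecture.FinalStateConjecture.Theorems.KerrShieldedDataExist.Negative (bentHeight)
open Summit.FinalStateConjecture.FinalStateConjecture.Theorems.BentLabDeviation
  (continuous_apply_zero continuous_spatialNorm bentLabDeviation_shiftDeviation_estimate)

namespace Summit.FinalStateConjecture.FinalStateConjecture.Cruxes.ModulatedKerrHandoff.SwallowTransfer

section Helpers

/-! ## Generic helpers -/

/-- Transfer of a bound on `‖Dᵐ E(x)‖` to a function `e` agreeing with `E` near `x`. [folklore] -/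
private theorem norm_iteratedFDeriv_le_of_eventuallyEq {e E : E4 → E4 →L[ℝ] E4 →L[ℝ] ℝ} {x : E4}
    {m : ℕ} {K : ℝ} (hev : e =ᶠ[𝓝 x] E) (hE : ‖iteratedFDeriv ℝ m E x‖ ≤ K) :
    ‖iteratedFDeriv ℝ m e x‖ ≤ K := by
  rwa [(hev.iteratedFDeriv ℝ m).eq_of_nhds]

/-- A function vanishing near `x` has all its derivatives `0` at `x`. [folklore] -/
private theorem iteratedFDeriv_eq_zero_of_eventuallyEq_zero {e : E4 → E4 →L[ℝ] E4 →L[ℝ] ℝ} {x : E4}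
    (hev : e =ᶠ[𝓝 x] fun _ ↦ 0) (m : ℕ) : iteratedFDeriv ℝ m e x = 0 := by
  rw [(hev.iteratedFDeriv ℝ m).eq_of_nhds, iteratedFDeriv_fun_zero]
  rfl

/-- If the shift `S` vanishes on an open set `W`, the time shift `y ↦ y + S(y) e₀` is the identity near every
point of `W`, so the time-shift deviation of any field `g` vanishes on `W`. [folklore] -/
private theorem shiftDeviation_eq_zero_of_forall_eq_zero {S : E4 → ℝ} {W : Set E4} (hW : IsOpen W)
    (hS : ∀ z ∈ W, S z = 0) (g : E4 → E4 →L[ℝ] E4 →L[ℝ] ℝ) {z : E4} (hz : z ∈ W) :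
    (g (z + S z • E4.basisVector 0)).bilinearComp
        (fderiv ℝ (fun y : E4 ↦ y + S y • E4.basisVector 0) z)
        (fderiv ℝ (fun y : E4 ↦ y + S y • E4.basisVector 0) z) - g z = 0 := by
  have hev : (fun y : E4 ↦ y + S y • E4.basisVector 0) =ᶠ[𝓝 z] id := by
    filter_upwards [hW.mem_nhds hz] with y hy
    rw [hS y hy, zero_smul, add_zero, id]
  rw [hev.fderiv_eq, fderiv_id, hS z hz, zero_smul, add_zero]
  ext v w
  simp [ContinuousLinearMap.bilinearComp_apply]

/-- `r(x) ≥ R` once `|x̲| ≥ t ≥ R + |a|` (`r² ≥ |x̲|² − a²`). [folklore] -/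
private theorem le_radius_of_le_spatialNorm {a R t : ℝ} {x : E4} (hR : 0 ≤ R) (ht : R + |a| ≤ t)
    (hx : t ≤ E4.spatialNorm x) : R ≤ Kerr.radius a x := by
  have h1 := Kerr.spatialNorm_sq_sub_sq_le_radius_sq a x
  have hr := Kerr.radius_nonneg a x
  have ha := abs_nonneg a
  have h0 : 0 ≤ R + |a| := by positivity
  have h2 : (R + |a|) ^ 2 ≤ E4.spatialNorm x ^ 2 := pow_le_pow_left₀ h0 (ht.trans hx) 2
  have h3 : R ^ 2 ≤ Kerr.radius a x ^ 2 := by nlinarith [sq_abs a, mul_nonneg hR ha]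
  exact (pow_le_pow_iff_left₀ hR hr two_ne_zero).1 h3

/-- **Uniform bounds on the Kerr–Schild form far out.** There are `N ≥ 0` and `R > 0` with
`‖Dʲ g_{M,a}(x)‖ ≤ N` for all `j ≤ 3` and all `x` with `r(x) ≥ R`: `g_{M,a} = η + (g_{M,a} − η)` with `η`
constant and `‖Dʲ(g_{M,a} − η)(x)‖ ≤ C_j / r(x)` for `r(x) ≥ R_j` (`Kerr.norm_iteratedFDeriv_ksPert_le`).
[folklore] -/
private theorem exists_bound_iteratedFDeriv_kerrBilin (M a : ℝ) :
    ∃ N R : ℝ, 0 ≤ N ∧ 0 < R ∧ ∀ x : E4, R ≤ Kerr.radius a x → ∀ j ≤ 3,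
      ‖iteratedFDeriv ℝ j (Kerr.bilin M a) x‖ ≤ N := by
  choose C R hR hCR using fun m ↦ Kerr.norm_iteratedFDeriv_ksPert_le M a m
  have hsR : 0 ≤ ∑ i ∈ Finset.range 4, R i := Finset.sum_nonneg fun i _ ↦ (hR i).le
  refine ⟨‖(Minkowski.bilin : E4 →L[ℝ] E4 →L[ℝ] ℝ)‖ + ∑ j ∈ Finset.range 4, |C j|,
    1 + ∑ j ∈ Finset.range 4, R j, by positivity, by linarith, fun x hx j hj ↦ ?_⟩
  have hj4 : j ∈ Finset.range 4 := Finset.mem_range.2 (by omega)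
  have hRj : R j ≤ Kerr.radius a x :=
    ((Finset.single_le_sum (f := R) (fun i _ ↦ (hR i).le) hj4).trans (by linarith)).trans hx
  have hr1 : 1 ≤ Kerr.radius a x := by linarith
  have hr0 : 0 < Kerr.radius a x := one_pos.trans_le hr1
  have hpert : ‖iteratedFDeriv ℝ j (fun y ↦ Kerr.bilin M a y - Minkowski.bilin) x‖ ≤ |C j| := by
    refine (hCR j x hRj).trans ?_
    calc C j / Kerr.radius a x ≤ |C j| / Kerr.radius a x :=
          div_le_div_of_nonneg_right (le_abs_self _) hr0.le
      _ ≤ |C j| := div_le_self (abs_nonneg _) hr1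
  have hCj : |C j| ≤ ∑ i ∈ Finset.range 4, |C i| :=
    Finset.single_le_sum (f := fun i ↦ |C i|) (fun i _ ↦ abs_nonneg (C i)) hj4
  have hη : 0 ≤ ‖(Minkowski.bilin : E4 →L[ℝ] E4 →L[ℝ] ℝ)‖ := norm_nonneg _
  rcases j with _ | k
  · rw [norm_iteratedFDeriv_zero] at hpert ⊢
    have hsub := norm_sub_norm_le (Kerr.bilin M a x) Minkowski.bilin
    linarith
  · have hfd : fderiv ℝ (fun y ↦ Kerr.bilin M a y - Minkowski.bilin) = fderiv ℝ (Kerr.bilin M a) := by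
      funext y
      exact fderiv_sub_const _
    rw [← norm_iteratedFDeriv_fderiv, hfd, norm_iteratedFDeriv_fderiv] at hpert
    linarith

end Helpers

section Deviation

variable {M a rin τ₀ : ℝ} {S : E4 → ℝ}

/-! ## The deviation of a time shift vanishing on the cone

In this section the shift `S` is arbitrary: only its vanishing on the open cone `{0 < x⁰, |x̲| < x⁰}`, its
smoothness on `{x⁰ > 0}` and the slab bounds on its derivatives are used. -/

/-- Near a point of the open cone `{0 < x⁰, |x̲| < x⁰}`, where the shift vanishes, the zero-extended deviation
vanishes identically: `f = id` there and both branches of `e` are `0`. [folklore] -/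
private theorem shiftDeviationExtend_eventuallyEq_zero
    (hS0 : ∀ z : E4, 0 < z 0 → E4.spatialNorm z < z 0 → S z = 0) {x : E4} (hx0 : 0 < x 0)
    (hin : E4.spatialNorm x < x 0) :
    (fun x : E4 ↦ if τ₀ < x 0 ∧ rin < Kerr.radius a x then
        (Kerr.bilin M a ((fun y : E4 ↦ y + S y • E4.basisVector 0) x)).bilinearComp
          (fderiv ℝ (fun y : E4 ↦ y + S y • E4.basisVector 0) x)
          (fderiv ℝ (fun y : E4 ↦ y + S y • E4.basisVector 0) x) - Kerr.bilin M a x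
        else 0) =ᶠ[𝓝 x] fun _ ↦ 0 := by
  have hWo : IsOpen {z : E4 | 0 < z 0 ∧ E4.spatialNorm z < z 0} :=
    (isOpen_lt continuous_const continuous_apply_zero).inter
      (isOpen_lt continuous_spatialNorm continuous_apply_zero)
  have hS : ∀ z ∈ {z : E4 | 0 < z 0 ∧ E4.spatialNorm z < z 0}, S z = 0 := fun z hz ↦ hS0 z hz.1 hz.2
  filter_upwards [hWo.mem_nhds ⟨hx0, hin⟩] with z hz
  beta_reduce
  split_ifs
  · exact shiftDeviation_eq_zero_of_forall_eq_zero hWo hS (Kerr.bilin M a) hz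
  · rfl

/-- **Clause (i) for a general shift.** The `C³` sup norm of the zero-extended deviation over the lab slab
`{x ∈ V | x⁰ = t}`, `V = {x⁰ > τ₀, r > rin}`, tends to `0`: eventually (`ε(t) ≤ 1`, `t ≥ max τ₁ (R + |a|)`) every
`‖Dᵐe(x)‖`, `m ≤ 3`, `x` in the slab, is `0` (inside the cone) or at most `3 · 4³ · N · max (ε t) 0` (the
time-shift engine on the open set `V`, where `g_{M,a}` is smooth and stationary). [folklore] -/
private theorem tendsto_supCkENorm_shiftDeviationExtend (h : |a| < M) (hrin : Kerr.rMinus M a < rin)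
    (hτ₀ : 0 < τ₀) (hS0 : ∀ z : E4, 0 < z 0 → E4.spatialNorm z < z 0 → S z = 0)
    (hS : ContDiffOn ℝ ∞ S {x : E4 | 0 < x 0}) {τ₁ : ℝ} {ε : ℝ → ℝ} (hε : Tendsto ε atTop (𝓝 0))
    (hb : ∀ x : E4, τ₁ ≤ x 0 → ∀ i : ℕ, 1 ≤ i → i ≤ 4 → ‖iteratedFDeriv ℝ i S x‖ ≤ ε (x 0)) :
    Tendsto (fun t : ℝ ↦ supCkENorm {x : E4 | (τ₀ < x 0 ∧ rin < Kerr.radius a x) ∧ x 0 = t} 3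
      (fun x : E4 ↦ if τ₀ < x 0 ∧ rin < Kerr.radius a x then
        (Kerr.bilin M a ((fun y : E4 ↦ y + S y • E4.basisVector 0) x)).bilinearComp
          (fderiv ℝ (fun y : E4 ↦ y + S y • E4.basisVector 0) x)
          (fderiv ℝ (fun y : E4 ↦ y + S y • E4.basisVector 0) x) - Kerr.bilin M a x
        else 0)) atTop (𝓝 0) := by
  obtain ⟨N, R, hN0, hR0, hN⟩ := exists_bound_iteratedFDeriv_kerrBilin M a
  -- the open set `V` and the data of the engine on it
  have hVo : IsOpen {x : E4 | τ₀ < x 0 ∧ rin < Kerr.radius a x} :=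
    (isOpen_lt continuous_const continuous_apply_zero).inter
      (isOpen_lt continuous_const (Kerr.continuous_radius a))
  have hr0 : ∀ y ∈ {x : E4 | τ₀ < x 0 ∧ rin < Kerr.radius a x}, 0 < Kerr.radius a y := fun y hy ↦
    (Kerr.IsSubextremal.rMinus_nonneg h).trans_lt (hrin.trans hy.2)
  have hSV : ContDiffOn ℝ ∞ S {x : E4 | τ₀ < x 0 ∧ rin < Kerr.radius a x} :=
    hS.mono fun y hy ↦ hτ₀.trans hy.1
  have hgV : ContDiffOn ℝ ∞ (Kerr.bilin M a) {x : E4 | τ₀ < x 0 ∧ rin < Kerr.radius a x} :=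
    fun y hy ↦ (Kerr.contDiffAt_bilin M a (hr0 y hy)).contDiffWithinAt
  have hstat : ∀ y ∈ {x : E4 | τ₀ < x 0 ∧ rin < Kerr.radius a x},
      Kerr.bilin M a (y + S y • E4.basisVector 0) = Kerr.bilin M a y := fun y _ ↦
    Kerr.bilin_add_smul_basisVector_zero M a y _
  -- the upper envelope `3 · 4³ · N · max (ε t) 0 → 0`
  have hK : Tendsto (fun t : ℝ ↦ ENNReal.ofReal (3 * 4 ^ 3 * N * max (ε t) 0)) atTop (𝓝 0) := by
    have h2 := ENNReal.tendsto_ofReal (hε.max_left.const_mul (3 * 4 ^ 3 * N))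
    rwa [mul_zero, ENNReal.ofReal_zero] at h2
  refine tendsto_of_tendsto_of_tendsto_of_le_of_le' tendsto_const_nhds hK
    (Eventually.of_forall fun _ ↦ zero_le) ?_
  filter_upwards [hε.eventually (eventually_le_nhds one_pos),
    eventually_ge_atTop (max τ₁ (R + |a|))] with t ht1 ht
  refine supCkENorm_le_ofReal fun m hm x hx ↦ ?_
  obtain ⟨hxV, hxt⟩ := hx
  have hε0 : 0 ≤ max (ε t) 0 := le_max_right _ _
  have hKt0 : 0 ≤ 3 * 4 ^ 3 * N * max (ε t) 0 := by positivity
  have hx0 : 0 < x 0 := hτ₀.trans hxV.1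
  rcases lt_or_ge (E4.spatialNorm x) (x 0) with hin | hout
  · -- inside the cone: `e ≡ 0` near `x`
    rw [iteratedFDeriv_eq_zero_of_eventuallyEq_zero (shiftDeviationExtend_eventuallyEq_zero hS0 hx0 hin) m,
      norm_zero]
    exact hKt0
  · -- outside the cone: `x ∈ V`, `r(x) ≥ R`, and the time-shift engine applies
    have hτ₁x : τ₁ ≤ x 0 := by
      rw [hxt]
      exact (le_max_left _ _).trans ht
    have hRa : R + |a| ≤ x 0 := by
      rw [hxt]
      exact (le_max_right _ _).trans ht
    have hRr : R ≤ Kerr.radius a x := le_radius_of_le_spatialNorm hR0.le hRa hout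
    refine norm_iteratedFDeriv_le_of_eventuallyEq
      (E := fun y ↦ (Kerr.bilin M a (y + S y • E4.basisVector 0)).bilinearComp
        (fderiv ℝ (fun y : E4 ↦ y + S y • E4.basisVector 0) y)
        (fderiv ℝ (fun y : E4 ↦ y + S y • E4.basisVector 0) y) - Kerr.bilin M a y) ?_ ?_
    · filter_upwards [hVo.mem_nhds hxV] with y hy
      exact if_pos hy
    · refine (bentLabDeviation_shiftDeviation_estimate hVo hSV hgV hstat hxV m hN0 hε0
        (max_le ht1 zero_le_one) (fun j hj ↦ hN x hRr j (hj.trans hm)) (fun i hi1 hi2 ↦ ?_)).trans ?_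
      · have hi := hb x hτ₁x i hi1 (by omega)
        rw [hxt] at hi
        exact hi.trans (le_max_left _ _)
      · have h4 : (4 : ℝ) ^ m ≤ 4 ^ 3 := pow_le_pow_right₀ (by norm_num) hm
        have h5 : 0 ≤ N * max (ε t) 0 := mul_nonneg hN0 hε0
        nlinarith

end Deviation

/-! ## The bent shift vanishes on the cone -/

/-- On the open cone `{0 < x⁰, |x̲| < x⁰}` the cutoff `χ₁(|x̲|/x⁰ − 1)`, hence the bent shift, vanishes
(`χ₁ = 0` on `(−∞, 0]`). [folklore] -/
private theorem bentShift_eq_zero_of_lt (M a : ℝ) :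
    ∀ z : E4, 0 < z 0 → E4.spatialNorm z < z 0 →
      Real.smoothTransition (E4.spatialNorm z / z 0 - 1) * bentHeight M a (E4.spatialNorm z) = 0 := by
  intro z hz0 hz
  rw [Real.smoothTransition.zero_of_nonpos (by rw [sub_nonpos, div_le_one hz0]; exact hz.le), zero_mul]

/-- **T3b `stub_bentLabDeviation`** (reshaped: the shift bounds of T3a enter as the last hypothesis, verbatim).
With `f` as in T2, the zero-extended deviation `e(x) = (f^* g_{M,a} − g_{M,a})(x)`
(`= g_{M,a}(f x)(Df·, Df·) − g_{M,a}(x)`) on the pinned domain `{x⁰ > τ₀, r > rin}`, `0` elsewhere, satisfies: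
(i) its `C³` sup on the lab slab `{x⁰ = t}` of the domain tends to `0` as `t → ∞`
(`tendsto_supCkENorm_shiftDeviationExtend` with the shift `Θ`: the time-shift engine
`BentLabDeviation.bentLabDeviation_shiftDeviation_estimate` on `V = {x⁰ > τ₀, r > rin}` outside the cone, where
`r ≥ R` for late `t` and `‖Dʲg_{M,a}‖ ≤ N`, `j ≤ 3`; `e ≡ 0` near points inside the cone);
(ii) ALL its derivatives vanish at every point with `x⁰ > τ₀`, `|x̲| ≤ x⁰/2` (there `Θ ≡ 0` on the neighbourhood
`{|x̲| < x⁰}`, so `f = id`, `Df = id` and BOTH branches are `0` near the point: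
`shiftDeviationExtend_eventuallyEq_zero`, `bentShift_eq_zero_of_lt`). [folklore] -/
theorem stub_bentLabDeviation : ∀ (M a rin : ℝ), |a| < M → Kerr.rMinus M a < rin → ∀ τ₀ : ℝ, 0 < τ₀ →
    (ContDiffOn ℝ ((⊤ : ℕ∞) : WithTop ℕ∞)
      (fun x : E4 ↦ Real.smoothTransition (E4.spatialNorm x / x 0 - 1) *
            bentHeight M a (E4.spatialNorm x))
      {x : E4 | 0 < x 0} ∧
    ∃ (τ₁ : ℝ) (ε : ℝ → ℝ), 0 < τ₁ ∧ Tendsto ε atTop (𝓝 0) ∧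
      ∀ x : E4, τ₁ ≤ x 0 → ∀ i : ℕ, 1 ≤ i → i ≤ 4 →
        ‖iteratedFDeriv ℝ i
          (fun x : E4 ↦ Real.smoothTransition (E4.spatialNorm x / x 0 - 1) *
            bentHeight M a (E4.spatialNorm x)) x‖ ≤ ε (x 0)) →
    Tendsto (fun t : ℝ ↦ supCkENorm {x : E4 | (τ₀ < x 0 ∧ rin < Kerr.radius a x) ∧ x 0 = t} 3
      (fun x : E4 ↦ if τ₀ < x 0 ∧ rin < Kerr.radius a x then
        (Kerr.bilin M a ((fun x : E4 ↦ x + (Real.smoothTransition (E4.spatialNorm x / x 0 - 1) *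
            bentHeight M a (E4.spatialNorm x)) • E4.basisVector 0) x)).bilinearComp
            (fderiv ℝ (fun x : E4 ↦ x + (Real.smoothTransition (E4.spatialNorm x / x 0 - 1) *
            bentHeight M a (E4.spatialNorm x)) • E4.basisVector 0) x)
            (fderiv ℝ (fun x : E4 ↦ x + (Real.smoothTransition (E4.spatialNorm x / x 0 - 1) *
            bentHeight M a (E4.spatialNorm x)) • E4.basisVector 0) x) - Kerr.bilin M a x
        else 0)) atTop (𝓝 0) ∧
    (∀ x : E4, τ₀ < x 0 → E4.spatialNorm x ≤ x 0 / 2 → ∀ m : ℕ,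
      iteratedFDeriv ℝ m (fun x : E4 ↦ if τ₀ < x 0 ∧ rin < Kerr.radius a x then
        (Kerr.bilin M a ((fun x : E4 ↦ x + (Real.smoothTransition (E4.spatialNorm x / x 0 - 1) *
            bentHeight M a (E4.spatialNorm x)) • E4.basisVector 0) x)).bilinearComp
            (fderiv ℝ (fun x : E4 ↦ x + (Real.smoothTransition (E4.spatialNorm x / x 0 - 1) *
            bentHeight M a (E4.spatialNorm x)) • E4.basisVector 0) x)
            (fderiv ℝ (fun x : E4 ↦ x + (Real.smoothTransition (E4.spatialNorm x / x 0 - 1) *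
            bentHeight M a (E4.spatialNorm x)) • E4.basisVector 0) x) - Kerr.bilin M a x
        else 0) x = 0) := by
  intro M a rin h hrin τ₀ hτ₀ hyp
  obtain ⟨hΘ, τ₁, ε, _, hε, hb⟩ := hyp
  refine ⟨tendsto_supCkENorm_shiftDeviationExtend h hrin hτ₀ (bentShift_eq_zero_of_lt M a) hΘ hε hb,
    fun x hx hxc m ↦ ?_⟩
  have hx0 : 0 < x 0 := hτ₀.trans hx
  exact iteratedFDeriv_eq_zero_of_eventuallyEq_zero
    (shiftDeviationExtend_eventuallyEq_zero (M := M) (a := a) (rin := rin) (τ₀ := τ₀)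
      (bentShift_eq_zero_of_lt M a) hx0 (by linarith)) m

end Summit.FinalStateConjecture.FinalStateConjecture.Cruxes.ModulatedKerrHandoff.SwallowTransfer

end
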